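import Literature.AlgebraicGeometry.Motives.HodgeStructureLefschetzGroupCenter
import Literature.AlgebraicGeometry.Motives.HodgeStructureRosatiCentreFactors
import HarnessLib

/-!
# THE CENTRE OF `S(A)(ℚ)` BY ALBERT TYPE: when the Rosati involutions act trivially on the centre `C₀` of `End⁰(A)` (types I–III)
# every central element of `S(A)(ℚ)` is an INVOLUTION, and for a totally real field centre `Z(S(H)(ℚ)) = {±1}`; for a CM centre
# `K` (type IV) `Z(S(H)(ℚ))` is the NORM-ONE GROUP `{x ∈ K | x x̄ = 1}` of `K` (Milne 1999 §1 p. 645, §2 p. 646)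

[topic AlgebraicGeometry/Motives]

Layer `Literature/AlgebraicGeometry/Motives`, lane `lit-hodgefound` (Track 2 foundations library; prover seat
`lit-hodgefound-p02`, generation 54, self-proposed row g54-#5). THEOREMS ONLY: no definition, no named fact (net debt `0`),
no instance, no notation.  Sequel of g54-#4 (`Motives/HodgeStructureLefschetzGroupCenter`: `γ ∈ S(H)(ℚ)` is central iff
`↑γ ∈ Z(E_φ)` — the centre of `S(A)(ℚ)` is Milne's `S₀(A)(ℚ) = {γ ∈ C₀(A) | γ†γ = 1}`, the `†`-unitary group of the centre `C₀`
of `End⁰(A)`).  Milne (p. 645): «Every Rosati involution `†` preserves each factor of `C₀(A)` and acts on it as complex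
conjugation»; §2 (p. 646): `K` = the centre of `E` (a field), `F` = the subfield of `K` on which the Rosati involutions act
trivially, «`K` equals `F` except when `A` is of type IV, in which case it is a CM-field of degree `2` over `F`».  Accordingly:
(i) if `†` is trivial on `Z(E_φ)` (FIRST KIND; types I–III, i.e. a totally real centre — the tree's
`Polarization.forall_adjointEndAlg_center_eq_self_iff_isTotallyReal`, `Motives/HodgeStructureRosatiCentreFactors`) then a central
`γ ∈ S(H)(ℚ)` satisfies `γ = γ† = γ⁻¹`, so `γ² = 1`; if moreover the centre is a FIELD (the isotypic case) then `γ = ±1`: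
`Z(S(H)(ℚ)) = {±1}`; (ii) if the centre is a CM field `K ≅ Z(E_φ)` (type IV; `†` = complex conjugation on `K`, the tree's
`Polarization.adjointEndAlg_ringEquiv_eq_complexConj`) then the central elements of `S(H)(ℚ)` are exactly the images of the
`x ∈ K` with `x x̄ = 1`, and every such `x` occurs: `Z(S(H)(ℚ)) ≅ U₁(K) = ker(N_{K/K⁺} : K^× → K⁺^×)`.

## The sources, verbatim

* J. S. Milne, *Lefschetz classes on abelian varieties*, Duke Math. J. 96 (1999) 639–675 [Milne1999LefschetzClasses] (held
  `paper:doi-10-1215-s0012-7094-99-09620-5`, folios 6–8): p. 644 L16–L24 "`S(A)(R) = {γ ∈ C(A) ⊗_k R | γ†γ = 1}` […] It is a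
  reductive group (not necessarily connected)"; p. 645 L1–L6 "let `C₀(A)` be the centre of the `ℚ`-algebra `End⁰(A)` — it is a
  product of fields, each of which is either a CM-field or `ℚ`. Every Rosati involution `†` preserves each factor of `C₀(A)` and
  acts on it as complex conjugation. Define `S₀(A)` […] `S₀(A)(R) = {γ ∈ C₀(A) ⊗_ℚ R | γ†γ = 1}`"; §2 p. 646 L10–L16 "`K` = the
  centre of `E` (a field), `F` = the subfield of `K` on which the Rosati involutions act trivially […] The field `F` is totally
  real, and `K` equals `F` except when `A` is of type IV, in which case it is a CM-field of degree 2 over `F`."; §2 Summary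
  p. 652 ("`A(IV)`: `U_{E⊗k}(φ)`").
* H. Lange, *Abelian Varieties over the Complex Numbers* (2023) [Lange2023AbelianVarietiesComplex], §2.6.2 Lemma 2.6.4 (first
  kind: trivial on the centre, which is then totally real) and Lemma 2.6.6 (second kind: the centre is a CM field and the
  anti-involution restricts to complex conjugation); §7.2.4 Exercise (4) (the Lefschetz group).
* G. Shimura, *Abelian Varieties with Complex Multiplication and Modular Functions* (1998) [Shimura1998], §5.1 Lemma 2 (p. 36).

## Dictionary and what is proved (namespace `Literature.AlgebraicGeometry.Motives.HodgeStructure`)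

`S(H)(ℚ) = ψ.lefschetzGroup ≤ GL(V)`, `Z(E_φ)` = `Subalgebra.center ℚ H.endAlg` (same carrier as `Subring.center H.endAlg`, used
by the tree's centre files with a field chart `g : K ≃+* Subring.center H.endAlg`), `†` = `ψ.adjoint` / `ψ.adjointEndAlg`,
`x̄ = NumberField.IsCMField.complexConj K x`.

* §1 FIRST KIND: **`Polarization.coe_mul_coe_eq_one_of_mem_center_lefschetzGroup`** (`†` trivial on `Z(E_φ)` ⟹ every central
  `γ ∈ S(H)(ℚ)` has `γ² = 1` in `End_ℚ(V)`), `Polarization.mul_self_eq_one_of_mem_center_lefschetzGroup` (in the group),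
  `Polarization.coe_mul_coe_eq_one_of_mem_center_lefschetzGroup_of_isTotallyReal` (totally real centre `K`),
  **`Polarization.mem_center_lefschetzGroup_iff_of_isTotallyReal`** (totally real FIELD centre: central iff `↑γ = ±1` —
  `Z(S(H)(ℚ)) = {±1}`, types I–III isotypic).
* §2 TYPE IV: **`Polarization.mem_center_lefschetzGroup_iff_of_isCMField`** (CM centre `K`: `γ` central iff `↑γ = g x` with
  `x x̄ = 1`), **`Polarization.exists_mem_center_lefschetzGroup_coe_eq_of_mul_complexConj_eq_one`** (every norm-one `x ∈ K` is
  attained by a central element of `S(H)(ℚ)`) — together `Z(S(H)(ℚ)) ≅ {x ∈ K | x x̄ = 1}`.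
-/

noncomputable section

open NumberField

namespace Literature.AlgebraicGeometry.Motives

namespace HodgeStructure

universe u

variable {V : Type u} [AddCommGroup V] [Module ℚ V] [Module.Finite ℚ V] {n : ℤ} {H : HodgeStructure V n}

omit [Module.Finite ℚ V] in
/-- The two spellings of the centre of `E_φ` have the same members. [folklore] -/
private theorem mem_center_iff_mem_subringCenter₅₄ (z : H.endAlg) :
    z ∈ Subalgebra.center ℚ H.endAlg ↔ z ∈ Subring.center H.endAlg := by
  rw [Subalgebra.mem_center_iff, Subring.mem_center_iff]

/-- A central `γ ∈ S(H)(ℚ)`: `↑γ = ↑z` for some `z ∈ Z(E_φ)` with `z† z = 1` (g54-#4 and Milne's `γ†γ = 1`).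
[cite: Milne1999LefschetzClasses, §1 p. 644 L16–L18 and p. 645 L1–L6] -/
private theorem Polarization.exists_center_coe_eq_of_mem_center₅₄ (ψ : Polarization H) {γ : ψ.lefschetzGroup}
    (hγ : γ ∈ Subgroup.center ψ.lefschetzGroup) :
    ∃ z : H.endAlg, z ∈ Subring.center H.endAlg ∧ (z : Module.End ℚ V) = ((γ : V ≃ₗ[ℚ] V) : Module.End ℚ V) ∧
      ψ.adjoint (z : Module.End ℚ V) * (z : Module.End ℚ V) = 1 := by
  obtain ⟨z, hz, hzγ⟩ := (ψ.mem_center_lefschetzGroup_iff_exists_mem_center γ).1 hγ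
  refine ⟨z, (mem_center_iff_mem_subringCenter₅₄ z).1 hz, hzγ, ?_⟩
  rw [hzγ]
  exact ((ψ.mem_lefschetzGroup_iff_adjoint_mul_self_eq_one _).1 γ.2).2

/-! ## §1 First kind (types I–III): central elements of `S(H)(ℚ)` are involutions; `Z(S(H)(ℚ)) = {±1}` for a field centre -/

/-- **`†` OF THE FIRST KIND ⟹ EVERY CENTRAL ELEMENT OF `S(A)(ℚ)` IS AN INVOLUTION**: if the Rosati involution acts trivially on the
centre `Z(E_φ) = C₀` (types I–III), then a central `γ ∈ S(H)(ℚ)` — which lies in `C₀` (g54-#4) with `γ†γ = 1` — satisfies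
`γ = γ†`, hence `γ² = 1` in `End_ℚ(V)`. [cite: Milne1999LefschetzClasses, §1 p. 645 L1–L6 and §2 p. 646 L10–L16]
[cite: Lange2023AbelianVarietiesComplex, §2.6.2 Lemma 2.6.4] -/
theorem Polarization.coe_mul_coe_eq_one_of_mem_center_lefschetzGroup (ψ : Polarization H)
    (hfix : ∀ z : H.endAlg, z ∈ Subalgebra.center ℚ H.endAlg → ψ.adjoint (z : Module.End ℚ V) = z)
    {γ : ψ.lefschetzGroup} (hγ : γ ∈ Subgroup.center ψ.lefschetzGroup) :
    ((γ : V ≃ₗ[ℚ] V) : Module.End ℚ V) * ((γ : V ≃ₗ[ℚ] V) : Module.End ℚ V) = 1 := by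
  obtain ⟨z, hz, hzγ, hU⟩ := ψ.exists_center_coe_eq_of_mem_center₅₄ hγ
  rw [hfix z ((mem_center_iff_mem_subringCenter₅₄ z).2 hz)] at hU
  rwa [hzγ] at hU

/-- The same in the group `S(H)(ℚ)`: `γ² = 1`. [cite: Milne1999LefschetzClasses, §1 p. 645 L1–L6 and §2 p. 646 L10–L16] -/
theorem Polarization.mul_self_eq_one_of_mem_center_lefschetzGroup (ψ : Polarization H)
    (hfix : ∀ z : H.endAlg, z ∈ Subalgebra.center ℚ H.endAlg → ψ.adjoint (z : Module.End ℚ V) = z)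
    {γ : ψ.lefschetzGroup} (hγ : γ ∈ Subgroup.center ψ.lefschetzGroup) : γ * γ = 1 := by
  refine Subtype.ext (LinearEquiv.toLinearMap_injective ?_)
  rw [Subgroup.coe_mul, Subgroup.coe_one, LinearEquiv.coe_toLinearMap_mul, LinearEquiv.coe_toLinearMap_one]
  exact ψ.coe_mul_coe_eq_one_of_mem_center_lefschetzGroup hfix hγ

section CentreField

variable {K : Type*} [Field K] [NumberField K]

/-- **TOTALLY REAL CENTRE ⟹ CENTRAL ELEMENTS OF `S(H)(ℚ)` ARE INVOLUTIONS**: if `Z(E_φ) ≅ K` is a totally real field (so `†` is of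
the first kind, the tree's `forall_adjointEndAlg_center_eq_self_iff_isTotallyReal`), every central `γ ∈ S(H)(ℚ)` has `γ² = 1`.
[cite: Milne1999LefschetzClasses, §2 p. 646 L10–L16] [cite: Lange2023AbelianVarietiesComplex, §2.6.2 Lemma 2.6.4] -/
theorem Polarization.coe_mul_coe_eq_one_of_mem_center_lefschetzGroup_of_isTotallyReal (ψ : Polarization H)
    (g : K ≃+* Subring.center H.endAlg) (hK : IsTotallyReal K)
    {γ : ψ.lefschetzGroup} (hγ : γ ∈ Subgroup.center ψ.lefschetzGroup) :
    ((γ : V ≃ₗ[ℚ] V) : Module.End ℚ V) * ((γ : V ≃ₗ[ℚ] V) : Module.End ℚ V) = 1 := by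
  refine ψ.coe_mul_coe_eq_one_of_mem_center_lefschetzGroup (fun z hz => ?_) hγ
  have h := congrArg Subtype.val ((ψ.forall_adjointEndAlg_center_eq_self_iff_isTotallyReal g).2 hK
    ⟨z, (mem_center_iff_mem_subringCenter₅₄ z).1 hz⟩)
  rwa [Polarization.coe_adjointEndAlg_apply] at h

/-- **`Z(S(H)(ℚ)) = {±1}` FOR A TOTALLY REAL FIELD CENTRE** (types I–III, isotypic): if `Z(E_φ) ≅ K` with `K` a totally real number
field, then `γ ∈ S(H)(ℚ)` is central iff `↑γ = 1` or `↑γ = -1` — a central `γ` is `↑z` for a `z ∈ Z(E_φ) ≅ K` with `z² = 1`, and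
in a field `z = ±1`. [cite: Milne1999LefschetzClasses, §2 p. 646 L10–L16 and Summary p. 652] [cite: Lange2023AbelianVarietiesComplex, §2.6.2 Lemma 2.6.4]
[cite: Shimura1998, §5.1 Lemma 2 (p. 36)] -/
theorem Polarization.mem_center_lefschetzGroup_iff_of_isTotallyReal (ψ : Polarization H)
    (g : K ≃+* Subring.center H.endAlg) (hK : IsTotallyReal K) (γ : ψ.lefschetzGroup) :
    γ ∈ Subgroup.center ψ.lefschetzGroup ↔
      ((γ : V ≃ₗ[ℚ] V) : Module.End ℚ V) = 1 ∨ ((γ : V ≃ₗ[ℚ] V) : Module.End ℚ V) = -1 := by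
  constructor
  · intro hγ
    obtain ⟨z, hz, hzγ, -⟩ := ψ.exists_center_coe_eq_of_mem_center₅₄ hγ
    have h2 := ψ.coe_mul_coe_eq_one_of_mem_center_lefschetzGroup_of_isTotallyReal g hK hγ
    rw [← hzγ] at h2
    -- `z² = 1` in the field `Z(E_φ) ≅ K`
    have hz2 : (⟨z, hz⟩ : Subring.center H.endAlg) * ⟨z, hz⟩ = 1 := Subtype.ext (Subtype.ext h2)
    set x : K := g.symm ⟨z, hz⟩ with hxdef
    have hgx : g x = ⟨z, hz⟩ := g.apply_symm_apply _
    have hx2 : x * x = 1 := g.injective (by rw [map_mul, map_one, hgx, hz2])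
    rw [← hzγ]
    rcases mul_self_eq_one_iff.1 hx2 with hx | hx
    · left
      have h1 : (⟨z, hz⟩ : Subring.center H.endAlg) = 1 := by rw [← hgx, hx, map_one]
      have h1' : z = 1 := congrArg Subtype.val h1
      rw [h1', OneMemClass.coe_one]
    · right
      have h1 : (⟨z, hz⟩ : Subring.center H.endAlg) = -1 := by rw [← hgx, hx, RingEquiv.map_neg_one]
      have h1' : z = -1 := congrArg Subtype.val h1
      rw [h1', NegMemClass.coe_neg, OneMemClass.coe_one]
  · rintro (h | h)
    · exact (ψ.mem_center_lefschetzGroup_iff γ).2 (h ▸ H.endAlg.one_mem)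
    · exact (ψ.mem_center_lefschetzGroup_iff γ).2 (h ▸ H.endAlg.neg_mem H.endAlg.one_mem)

/-! ## §2 Type IV: for a CM centre `K`, `Z(S(H)(ℚ))` is the norm-one group `{x ∈ K | x x̄ = 1}` -/

/-- **TYPE IV: A `γ ∈ S(H)(ℚ)` IS CENTRAL IFF `↑γ = g(x)` WITH `x x̄ = 1`**: if the centre `Z(E_φ) ≅ K` is a CM field, on which
`†` acts as complex conjugation `x ↦ x̄` (the tree's `adjointEndAlg_ringEquiv_eq_complexConj`), then the central elements of
`S(H)(ℚ)` — the `†`-unitary central endomorphisms (g54-#4) — are exactly the images of the norm-one elements of `K`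
(Milne's `S₀`; «`A(IV)`: `U_{E⊗k}(φ)`» has centre the norm-one torus of `K`). [cite: Milne1999LefschetzClasses, §1 p. 645 L1–L6, §2 p. 646 L10–L16 and Summary p. 652]
[cite: Lange2023AbelianVarietiesComplex, §2.6.2 Lemma 2.6.6 (p. 144)] -/
theorem Polarization.mem_center_lefschetzGroup_iff_of_isCMField [IsCMField K] (ψ : Polarization H)
    (g : K ≃+* Subring.center H.endAlg) (γ : ψ.lefschetzGroup) :
    γ ∈ Subgroup.center ψ.lefschetzGroup ↔
      ∃ x : K, x * IsCMField.complexConj K x = 1 ∧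
        ((γ : V ≃ₗ[ℚ] V) : Module.End ℚ V) = (((g x : Subring.center H.endAlg) : H.endAlg) : Module.End ℚ V) := by
  constructor
  · intro hγ
    obtain ⟨z, hz, hzγ, hU⟩ := ψ.exists_center_coe_eq_of_mem_center₅₄ hγ
    set x : K := g.symm ⟨z, hz⟩ with hxdef
    have hgx : g x = ⟨z, hz⟩ := g.apply_symm_apply _
    have hzx : z = ((g x : Subring.center H.endAlg) : H.endAlg) := by rw [hgx]
    refine ⟨x, ?_, by rw [← hzγ, hzx]⟩
    -- `z† z = 1` reads `g(x̄) g(x) = 1`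
    rw [hzx, ← ψ.coe_adjointEndAlg_apply, ψ.adjointEndAlg_ringEquiv_eq_complexConj g x] at hU
    have hU' : (g (IsCMField.complexConj K x) : Subring.center H.endAlg) * g x = 1 :=
      Subtype.ext (Subtype.ext hU)
    rw [← map_mul, ← map_one g] at hU'
    rw [mul_comm]
    exact g.injective hU'
  · rintro ⟨x, -, hx⟩
    refine (ψ.mem_center_lefschetzGroup_iff γ).2 ?_
    rw [hx]
    exact ((g x : Subring.center H.endAlg) : H.endAlg).2

/-- **TYPE IV: EVERY NORM-ONE `x ∈ K` IS A CENTRAL ELEMENT OF `S(H)(ℚ)`**: for `x x̄ = 1` the central endomorphism `z = g(x)` is a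
unit of `E_φ` with `z† z = g(x̄ x) = 1`, so `z ∈ S(H)(ℚ)` (Milne's `{γ ∈ C(A) | γ†γ = 1}`, the tree's
`mem_lefschetzGroup_iff_adjoint_mul_self_eq_one`), and it is central (g54-#4).  With the previous statement:
`Z(S(H)(ℚ)) ≅ {x ∈ K | x x̄ = 1}`. [cite: Milne1999LefschetzClasses, §1 p. 644 L16–L18, p. 645 L1–L6 and §2 Summary p. 652]
[cite: Lange2023AbelianVarietiesComplex, §2.6.2 Lemma 2.6.6 (p. 144)] -/
theorem Polarization.exists_mem_center_lefschetzGroup_coe_eq_of_mul_complexConj_eq_one [IsCMField K] (ψ : Polarization H)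
    (g : K ≃+* Subring.center H.endAlg) {x : K} (hx : x * IsCMField.complexConj K x = 1) :
    ∃ γ : ψ.lefschetzGroup, γ ∈ Subgroup.center ψ.lefschetzGroup ∧
      ((γ : V ≃ₗ[ℚ] V) : Module.End ℚ V) = (((g x : Subring.center H.endAlg) : H.endAlg) : Module.End ℚ V) := by
  set z : H.endAlg := ((g x : Subring.center H.endAlg) : H.endAlg) with hzdef
  -- `z` is a unit of `End_ℚ(V)`
  have hx0 : x ≠ 0 := by
    rintro rfl
    rw [zero_mul] at hx
    exact zero_ne_one hx
  have hzU : IsUnit (z : Module.End ℚ V) :=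
    (((isUnit_iff_ne_zero.2 hx0).map g).map (Subring.center H.endAlg).subtype).map H.endAlg.val
  set γ₀ : V ≃ₗ[ℚ] V := LinearMap.GeneralLinearGroup.generalLinearEquiv ℚ V hzU.unit with hγ₀def
  have hγ₀ : (γ₀ : Module.End ℚ V) = z := by
    rw [hγ₀def, LinearMap.GeneralLinearGroup.generalLinearEquiv_to_linearMap, IsUnit.unit_spec]
  -- `z ∈ C(H)` (central in `E_φ`) and `z† z = g(x̄) g(x) = g(x̄ x) = 1`
  have hzc : z ∈ Subalgebra.center ℚ H.endAlg :=
    (mem_center_iff_mem_subringCenter₅₄ z).2 (g x).2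
  have hzC : (z : Module.End ℚ V) ∈ Subalgebra.centralizer ℚ (H.endAlg : Set (Module.End ℚ V)) :=
    (mem_center_endAlg_iff_coe_mem_centralizer_endAlg H z).1 hzc
  have hunit : ψ.adjoint (z : Module.End ℚ V) * (z : Module.End ℚ V) = 1 := by
    have h1 : (g (IsCMField.complexConj K x) : Subring.center H.endAlg) * g x = 1 := by
      rw [← map_mul, mul_comm, hx, map_one]
    have h2 := congrArg (fun c : Subring.center H.endAlg => ((c : H.endAlg) : Module.End ℚ V)) h1
    simp only [Subring.coe_mul, Subalgebra.coe_mul, OneMemClass.coe_one] at h2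
    rw [hzdef, ← ψ.coe_adjointEndAlg_apply, ψ.adjointEndAlg_ringEquiv_eq_complexConj g x]
    exact h2
  have hγ₀S : γ₀ ∈ ψ.lefschetzGroup := by
    rw [ψ.mem_lefschetzGroup_iff_adjoint_mul_self_eq_one, hγ₀]
    exact ⟨hzC, hunit⟩
  refine ⟨⟨γ₀, hγ₀S⟩, (ψ.mem_center_lefschetzGroup_iff _).2 ?_, hγ₀⟩
  change (γ₀ : Module.End ℚ V) ∈ H.endAlg
  rw [hγ₀]
  exact z.2

end CentreField

end HodgeStructure

end Literature.AlgebraicGeometry.Motives
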